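import Literature.NumberTheory.LFunctions.ZetaHeatExplicitFormula
import Literature.NumberTheory.LFunctions.ZetaHeatKernelTaylor
import Literature.Analysis.SpecialFunctions.GaussianInvSinhEulerMascheroni
import HarnessLib

/-!
# Connes 2024, Theorem 1.1 (= Connes 2026 Letter, Theorem 7.3): the heat expansion of the zeros — PROVED
# (`Connes2024_heat_thm_1_1_holds`, conditional on RH exactly as printed)

LABEL (line 1): RH-FREE literature — the statement CARRIES RH as its printed hypothesis (RH puts the zeros on the
critical line, so that the zero side of the explicit formula is the heat trace `Σ_ρ m(ρ)e^{−tγ²}`); nothing here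
bears on the truth of RH.  Cell `rh-crit`, sub-cell `cc/`, row O1; bears_on: W-C/W-P (C1) record only.
WHAT THIS IS NOT: a construction of the operator `D`, or anything bearing on RH.

This file discharges the named fact `Literature.NumberTheory.LFunctions.Connes2024_heat_thm_1_1`
(`ZetaHeatExpansion.lean`): under `RiemannHypothesis`, the heat trace `zetaHeatTrace t = Σ_ρ m(ρ)e^{−t(Im ρ)²}` is
summable for every `t > 0` and, for every `N`,
`zetaHeatTrace t − (heatMainTerm t + Σ_{n<N} a_n t^{n/2}) = O(t^{N/2})` as `t → 0⁺`.

Source and proof followed: A. Connes, *Heat expansion and zeta*, arXiv:2402.13082 = Ann. Funct. Anal. 15 (2024),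
§§2–4 (held text `paper:arxiv-2402.13082`, pp. 4–7).  The printed proof has four parts, formalised in four files:
* (A) §§2–3, the explicit formula of [EB] for the Gaussian `F_t` (`F̂_t(s) = e^{−ts²}`):
  `Σ_Z e^{−tρ²} = 2e^{t/4} − W_ℝ(F_t) − ψ(t)` — `ZetaHeatExplicitFormula.lean`
  (`ZetaHeatExplicit.zetaHeatTrace_eq`, `ZetaHeatExplicit.summable_zetaHeatTerm`);
* (B) Lemma 3.1, the Taylor expansion at `0` of `r(u) = e^{u/2}/(e^u − e^{−u}) − 1/(2u) = Σ b_n u^n` with a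
  remainder estimate `|r(u) − Σ_{n<N} b_n u^n| ≤ C_N u^N` on all of `(0, ∞)` — `ZetaHeatKernelTaylor.lean`
  (`ZetaHeatKernelTaylor.abs_heatKernel_sub_sum_le_of_pos`);
* (C) the archimedean constant: `∫₀^∞ (e^{−u²/4t}/u − 1/sinh u) du = (log t − γ)/2`, which produces the two
  divergent terms `log(1/t)/(4√π√t) − (log 4π + γ/2)/(2√π√t)` of (1.1) out of `W_ℝ(F_t)` —
  `Literature/Analysis/SpecialFunctions/GaussianInvSinhEulerMascheroni.lean`
  (`integral_exp_neg_sq_div_sub_inv_sinh`);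
* (D) this file: §3 "one gets `−W_ℝ(F_t) = log(1/t)/(4√π√t) − (log 4π + γ/2)/(2√π√t) − ∫₀^∞ 2F_t(e^u) r(u) du`",
  Lemma 3.2 "`∫₀^∞ 2F_t(e^y) r(y) dy` admits the expansion `−Σ a_n t^{n/2}`, `a_n = −2^n Γ((n+1)/2) b_n/√π`"
  (proof: "we use the equality `∫₀^∞ 2F_t(e^y) yⁿ dy = 2ⁿ t^{n/2} Γ((n+1)/2)/√π`" = the tree's
  `integral_two_heatTest_mul_pow`, applied termwise to Lemma 3.1 with its remainder), and §4 "the primes do not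
  contribute": `|ψ(t)| ≤ 4(π²/6 − 1)e^{−(log 2)²/4t}/(√π√t)` for `t ≤ t₀ = (log 6)/8` (the tree's
  `abs_heatPrimeSum_le`), which is `O(t^{N/2})` for every `N` since `e^{−a/t} ≤ (N+1)! t^{N+1}/a^{N+1}`.

DEVIATION FROM PRINT (declared): the printed `W_ℝ(F_t)` is split pointwise on `(0,∞)` as
`(e^{y/2}h_t(y) − h_t(0))/sinh y = 2h_t(y) r(y) + h_t(0)(e^{−y²/4t}/y − 1/sinh y)` (`h_t(y) = F_t(e^y) =
e^{−y²/4t}/(2√π√t)`), and the second piece is evaluated by (C); Connes instead quotes the value of `c = ½(log π + γ/2)`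
from [3].  Theorems only; no definition, no new named fact (D-0026); net debt −1.
-/

noncomputable section

open Real Filter Set MeasureTheory Topology Asymptotics Finset

namespace Literature.NumberTheory.LFunctions

open ZetaHeatExplicit ZetaHeatKernelTaylor Literature.Analysis.SpecialFunctions

/-! ## Step 1 (§3): `W_ℝ(F_t)` = the Lemma 3.2 integral + the archimedean constant -/

/-- The pointwise splitting of Bombieri's archimedean integrand of the Gaussian on `(0, ∞)`:
`(e^{y/2}h_t(y) − h_t(0))/sinh y = 2h_t(y)·r(y) + h_t(0)·(e^{−y²/4t}/y − 1/sinh y)`,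
`r(y) = e^{y/2}/(e^y − e^{−y}) − 1/(2y)`. [folklore] -/
private theorem bombieriIntegrand_eq {t : ℝ} (ht : 0 < t) {y : ℝ} (hy : 0 < y) :
    (Real.exp (y / 2) * (Real.exp (-y ^ 2 / (4 * t)) / (2 * √π * √t)) - 1 / (2 * √π * √t)) / Real.sinh y =
      Real.exp (-y ^ 2 / (4 * t)) / (√π * √t) *
          (Real.exp (y / 2) / (Real.exp y - Real.exp (-y)) - 1 / (2 * y)) +
        1 / (2 * √π * √t) * (Real.exp (-y ^ 2 / (4 * t)) / y - 1 / Real.sinh y) := by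
  have h1 : Real.exp y - Real.exp (-y) ≠ 0 :=
    (sub_pos.mpr (Real.exp_lt_exp.mpr (by linarith))).ne'
  have hπ : √π ≠ 0 := (Real.sqrt_pos.mpr Real.pi_pos).ne'
  have ht' : √t ≠ 0 := (Real.sqrt_pos.mpr ht).ne'
  have hy' : y ≠ 0 := hy.ne'
  rw [Real.sinh_eq]
  field_simp
  ring

/-- `y ↦ 2F_t(e^y) yⁿ = e^{−y²/4t} yⁿ/(√π√t)` is integrable on `(0, ∞)`. [folklore] -/
private theorem integrableOn_twoHeat_mul_pow {t : ℝ} (ht : 0 < t) (n : ℕ) :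
    IntegrableOn (fun y : ℝ => Real.exp (-y ^ 2 / (4 * t)) / (√π * √t) * y ^ n) (Ioi 0) := by
  have hb : (0 : ℝ) < 1 / (4 * t) := by positivity
  have hs : (-1 : ℝ) < (n : ℝ) := by have := (n.cast_nonneg : (0 : ℝ) ≤ n); linarith
  have h := (integrableOn_rpow_mul_exp_neg_mul_sq hb hs).const_mul (1 / (√π * √t))
  refine IntegrableOn.congr_fun h (fun y _ => ?_) measurableSet_Ioi
  rw [Real.rpow_natCast]
  have : -(1 / (4 * t)) * y ^ 2 = -y ^ 2 / (4 * t) := by field_simp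
  rw [this]
  ring

/-- `r(y) = e^{y/2}/(e^y − e^{−y}) − 1/(2y)` is continuous on `(0, ∞)`. [folklore] -/
private theorem continuousOn_heatKernelR :
    ContinuousOn (fun y : ℝ => Real.exp (y / 2) / (Real.exp y - Real.exp (-y)) - 1 / (2 * y)) (Ioi 0) := by
  intro y hy
  have hy0 : 0 < y := hy
  have h1 : Real.exp y - Real.exp (-y) ≠ 0 :=
    (sub_pos.mpr (Real.exp_lt_exp.mpr (by linarith))).ne'
  have h2 : (2 * y) ≠ 0 := by positivity
  exact (((by fun_prop : Continuous fun y : ℝ => Real.exp (y / 2)).continuousAt.div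
    (by fun_prop : Continuous fun y : ℝ => Real.exp y - Real.exp (-y)).continuousAt h1).sub
    (continuousAt_const.div (by fun_prop : Continuous fun y : ℝ => 2 * y).continuousAt h2)).continuousWithinAt

/-- `2F_t(e^y) r(y)` is integrable on `(0, ∞)` (`r` is bounded there, by Lemma 3.1 with `N = 0`). [folklore] -/
private theorem integrableOn_twoHeat_mul_r {t : ℝ} (ht : 0 < t) :
    IntegrableOn (fun y : ℝ => Real.exp (-y ^ 2 / (4 * t)) / (√π * √t) *
      (Real.exp (y / 2) / (Real.exp y - Real.exp (-y)) - 1 / (2 * y))) (Ioi 0) := by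
  obtain ⟨C, hC⟩ := abs_heatKernel_sub_sum_le_of_pos 0
  have h0 := integrableOn_twoHeat_mul_pow ht 0
  simp only [pow_zero, mul_one] at h0
  refine Integrable.mul_bdd (c := C) h0
    (continuousOn_heatKernelR.aestronglyMeasurable measurableSet_Ioi) ?_
  rw [ae_restrict_iff' measurableSet_Ioi]
  refine Eventually.of_forall fun y (hy : 0 < y) => ?_
  have := hC y hy
  simp only [sum_range_zero, sub_zero, pow_zero, mul_one] at this
  rw [Real.norm_eq_abs]
  exact this

/-- **Connes 2024 §3: "one gets `−W_ℝ(F_t) = log(1/t)/(4√π√t) − (log 4π + γ/2)/(2√π√t) − ∫₀^∞ 2F_t(e^u) r(u) du`",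
combined with the explicit formula `Σ_Z e^{−tρ²} = 2e^{t/4} − W_ℝ(F_t) − ψ(t)`** — under RH, for `0 < t ≤ (log 6)/8`:
`Tr(e^{−tD²}) − (log(1/t)/(4√π√t) − (log 4π + γ/2)/(2√π√t) + 2e^{t/4}) = −ψ(t) − ∫₀^∞ 2F_t(e^y) r(y) dy`
(`2F_t(e^y) = e^{−y²/4t}/(√π√t)`, `r(y) = e^{y/2}/(e^y − e^{−y}) − 1/(2y)`).
[cite: Connes2024HeatExpansion, §3, displays from `W_ℝ(F_t) = …` to `−W_ℝ(F_t) = …` (arXiv p0005:L14–L32)] -/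
theorem zetaHeatTrace_sub_heatMainTerm (hRH : RiemannHypothesis) {t : ℝ} (ht : 0 < t)
    (ht0 : t ≤ Real.log 6 / 8) :
    zetaHeatTrace t - heatMainTerm t =
      -heatPrimeSum t - ∫ y in Ioi (0 : ℝ), Real.exp (-y ^ 2 / (4 * t)) / (√π * √t) *
        (Real.exp (y / 2) / (Real.exp y - Real.exp (-y)) - 1 / (2 * y)) := by
  rw [zetaHeatTrace_eq hRH ht ht0]
  have hI : ∫ y in Ioi (0 : ℝ), (Real.exp (y / 2) * (Real.exp (-y ^ 2 / (4 * t)) / (2 * √π * √t)) -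
      1 / (2 * √π * √t)) / Real.sinh y =
      (∫ y in Ioi (0 : ℝ), Real.exp (-y ^ 2 / (4 * t)) / (√π * √t) *
        (Real.exp (y / 2) / (Real.exp y - Real.exp (-y)) - 1 / (2 * y))) +
      1 / (2 * √π * √t) * ((Real.log t - Real.eulerMascheroniConstant) / 2) := by
    rw [← integral_exp_neg_sq_div_sub_inv_sinh ht, ← integral_const_mul, ← integral_add
      (integrableOn_twoHeat_mul_r ht) ((integrableOn_exp_neg_sq_div_sub_inv_sinh ht).const_mul _)]
    exact setIntegral_congr_fun measurableSet_Ioi fun y hy => bombieriIntegrand_eq ht hy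
  rw [hI, heatMainTerm, one_div t, Real.log_inv]
  ring

/-! ## Step 2 (Lemma 3.2): the expansion of `∫₀^∞ 2F_t(e^y) r(y) dy` with remainder -/

/-- Termwise integration of Lemma 3.1: for every `N`,
`∫₀^∞ 2F_t(e^y) r(y) dy = −Σ_{n<N} a_n t^{n/2} + ∫₀^∞ 2F_t(e^y)(r(y) − Σ_{n<N} b_n yⁿ) dy`
("using (3.6) … `a_n = −2ⁿ Γ((n+1)/2) b_n/√π`"). [cite: Connes2024HeatExpansion, Lemma 3.2 and its proof (arXiv p0006:L38–L48)] -/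
theorem integral_twoHeat_mul_r_eq {t : ℝ} (ht : 0 < t) (N : ℕ) :
    ∫ y in Ioi (0 : ℝ), Real.exp (-y ^ 2 / (4 * t)) / (√π * √t) *
        (Real.exp (y / 2) / (Real.exp y - Real.exp (-y)) - 1 / (2 * y)) =
      -(∑ n ∈ range N, heatCoeff n * t ^ ((n : ℝ) / 2)) +
        ∫ y in Ioi (0 : ℝ), Real.exp (-y ^ 2 / (4 * t)) / (√π * √t) *
          (Real.exp (y / 2) / (Real.exp y - Real.exp (-y)) - 1 / (2 * y) -
            ∑ n ∈ range N, heatCoeffB n * y ^ n) := by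
  have hpow : ∀ n, IntegrableOn (fun y : ℝ => Real.exp (-y ^ 2 / (4 * t)) / (√π * √t) * y ^ n) (Ioi 0) :=
    fun n => integrableOn_twoHeat_mul_pow ht n
  have hr := integrableOn_twoHeat_mul_r ht
  have hsum : IntegrableOn (fun y : ℝ => ∑ n ∈ range N,
      heatCoeffB n * (Real.exp (-y ^ 2 / (4 * t)) / (√π * √t) * y ^ n)) (Ioi 0) :=
    integrable_finsetSum _ fun n _ => (hpow n).const_mul _
  -- pointwise: `2h r = Σ b_n (2h yⁿ) + 2h (r − Σ b_n yⁿ)`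
  have hpt : ∀ y : ℝ, Real.exp (-y ^ 2 / (4 * t)) / (√π * √t) *
      (Real.exp (y / 2) / (Real.exp y - Real.exp (-y)) - 1 / (2 * y)) =
      (∑ n ∈ range N, heatCoeffB n * (Real.exp (-y ^ 2 / (4 * t)) / (√π * √t) * y ^ n)) +
        Real.exp (-y ^ 2 / (4 * t)) / (√π * √t) *
          (Real.exp (y / 2) / (Real.exp y - Real.exp (-y)) - 1 / (2 * y) -
            ∑ n ∈ range N, heatCoeffB n * y ^ n) := by
    intro y
    have hS : ∑ n ∈ range N, heatCoeffB n * (Real.exp (-y ^ 2 / (4 * t)) / (√π * √t) * y ^ n) =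
        Real.exp (-y ^ 2 / (4 * t)) / (√π * √t) * ∑ n ∈ range N, heatCoeffB n * y ^ n := by
      rw [Finset.mul_sum]
      exact Finset.sum_congr rfl fun n _ => mul_left_comm _ _ _
    rw [hS]
    ring
  have hR : IntegrableOn (fun y : ℝ => Real.exp (-y ^ 2 / (4 * t)) / (√π * √t) *
      (Real.exp (y / 2) / (Real.exp y - Real.exp (-y)) - 1 / (2 * y) -
        ∑ n ∈ range N, heatCoeffB n * y ^ n)) (Ioi 0) := by
    refine IntegrableOn.congr_fun (hr.sub hsum) (fun y _ => ?_) measurableSet_Ioi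
    rw [Pi.sub_apply, hpt y]
    ring
  calc ∫ y in Ioi (0 : ℝ), Real.exp (-y ^ 2 / (4 * t)) / (√π * √t) *
        (Real.exp (y / 2) / (Real.exp y - Real.exp (-y)) - 1 / (2 * y))
      = ∫ y in Ioi (0 : ℝ), ((∑ n ∈ range N,
          heatCoeffB n * (Real.exp (-y ^ 2 / (4 * t)) / (√π * √t) * y ^ n)) +
          Real.exp (-y ^ 2 / (4 * t)) / (√π * √t) *
            (Real.exp (y / 2) / (Real.exp y - Real.exp (-y)) - 1 / (2 * y) -
              ∑ n ∈ range N, heatCoeffB n * y ^ n)) :=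
        setIntegral_congr_fun measurableSet_Ioi fun y _ => hpt y
    _ = (∑ n ∈ range N, heatCoeffB n * ∫ y in Ioi (0 : ℝ), Real.exp (-y ^ 2 / (4 * t)) / (√π * √t) * y ^ n) +
          ∫ y in Ioi (0 : ℝ), Real.exp (-y ^ 2 / (4 * t)) / (√π * √t) *
            (Real.exp (y / 2) / (Real.exp y - Real.exp (-y)) - 1 / (2 * y) -
              ∑ n ∈ range N, heatCoeffB n * y ^ n) := by
        rw [integral_add hsum hR, integral_finsetSum _ fun n _ => (hpow n).const_mul _]
        simp only [integral_const_mul]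
    _ = _ := by
        simp only [integral_two_heatTest_mul_pow ht]
        rw [← Finset.sum_neg_distrib]
        congr 1
        refine Finset.sum_congr rfl fun n _ => ?_
        rw [heatCoeff]
        ring

/-- The remainder of Lemma 3.2: if `|r(u) − Σ_{n<N} b_n uⁿ| ≤ C uᴺ` on `(0,∞)` (Lemma 3.1), then
`|∫₀^∞ 2F_t(e^y)(r(y) − Σ_{n<N} b_n yⁿ) dy| ≤ C · 2ᴺ t^{N/2} Γ((N+1)/2)/√π`.
[cite: Connes2024HeatExpansion, Lemma 3.2 proof, display (3.6) (arXiv p0006:L44)] -/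
theorem abs_integral_twoHeat_mul_rem_le {t : ℝ} (ht : 0 < t) (N : ℕ) {C : ℝ}
    (hC : ∀ u : ℝ, 0 < u → |Real.exp (u / 2) / (Real.exp u - Real.exp (-u)) - 1 / (2 * u) -
        ∑ n ∈ range N, heatCoeffB n * u ^ n| ≤ C * u ^ N) :
    |∫ y in Ioi (0 : ℝ), Real.exp (-y ^ 2 / (4 * t)) / (√π * √t) *
        (Real.exp (y / 2) / (Real.exp y - Real.exp (-y)) - 1 / (2 * y) -
          ∑ n ∈ range N, heatCoeffB n * y ^ n)| ≤
      C * (2 ^ N * t ^ ((N : ℝ) / 2) * Real.Gamma (((N : ℝ) + 1) / 2) / √π) := by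
  rw [← integral_two_heatTest_mul_pow ht N, ← integral_const_mul, ← Real.norm_eq_abs]
  refine norm_integral_le_of_norm_le ((integrableOn_twoHeat_mul_pow ht N).const_mul C) ?_
  rw [ae_restrict_iff' measurableSet_Ioi]
  refine Eventually.of_forall fun y (hy : 0 < y) => ?_
  have hE : 0 ≤ Real.exp (-y ^ 2 / (4 * t)) / (√π * √t) := by positivity
  rw [norm_mul, Real.norm_eq_abs, abs_of_nonneg hE, Real.norm_eq_abs]
  calc Real.exp (-y ^ 2 / (4 * t)) / (√π * √t) *
        |Real.exp (y / 2) / (Real.exp y - Real.exp (-y)) - 1 / (2 * y) - ∑ n ∈ range N, heatCoeffB n * y ^ n|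
      ≤ Real.exp (-y ^ 2 / (4 * t)) / (√π * √t) * (C * y ^ N) := mul_le_mul_of_nonneg_left (hC y hy) hE
    _ = C * (Real.exp (-y ^ 2 / (4 * t)) / (√π * √t) * y ^ N) := by ring

/-! ## Step 3 (§4): the primes do not contribute -/

/-- **§4**: for every `N` there is `K` with `|ψ(t)| ≤ K t^{N/2}` for `0 < t ≤ t₀ = (log 6)/8` — from
`|ψ(t)| ≤ 4(π²/6 − 1) e^{−(log 2)²/4t}/(√π√t)` (`abs_heatPrimeSum_le`) and `e^{−a/t} ≤ (N+1)! t^{N+1}/a^{N+1}`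
("which shows that it does not contribute to the asymptotic expansion when `t → 0`").
[cite: Connes2024HeatExpansion, §4 second display and the sentence after it (arXiv p0007:L13–L16)] -/
theorem abs_heatPrimeSum_le_rpow (N : ℕ) : ∃ K : ℝ, ∀ t : ℝ, 0 < t → t ≤ Real.log 6 / 8 →
    |heatPrimeSum t| ≤ K * t ^ ((N : ℝ) / 2) := by
  have ha0 : 0 < Real.log 2 ^ 2 / 4 := by have := Real.log_pos one_lt_two; positivity
  refine ⟨4 * (π ^ 2 / 6 - 1) / √π * ((N + 1).factorial / (Real.log 2 ^ 2 / 4) ^ (N + 1)),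
    fun t ht ht0 => ?_⟩
  have ht1 : t ≤ 1 :=
    ht0.trans (by have := Real.log_le_sub_one_of_pos (by norm_num : (0 : ℝ) < 6); linarith)
  have hψ := abs_heatPrimeSum_le ht ht0
  have hπ : 0 < √π := Real.sqrt_pos.mpr Real.pi_pos
  have hst : 0 < √t := Real.sqrt_pos.mpr ht
  have hc : 0 ≤ 4 * (π ^ 2 / 6 - 1) := by nlinarith [Real.pi_gt_three]
  -- `e^{−a/t} ≤ (N+1)! t^{N+1}/a^{N+1}`
  have hexp : Real.exp (-Real.log 2 ^ 2 / (4 * t)) ≤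
      (N + 1).factorial * t ^ (N + 1) / (Real.log 2 ^ 2 / 4) ^ (N + 1) := by
    have hx : 0 ≤ Real.log 2 ^ 2 / 4 / t := by positivity
    have h1 := Real.pow_div_factorial_le_exp _ hx (N + 1)
    have h2 : Real.exp (-Real.log 2 ^ 2 / (4 * t)) = (Real.exp (Real.log 2 ^ 2 / 4 / t))⁻¹ := by
      rw [← Real.exp_neg]
      congr 1
      field_simp
    rw [h2]
    have hpos : 0 < (Real.log 2 ^ 2 / 4 / t) ^ (N + 1) / (N + 1).factorial := by positivity
    calc (Real.exp (Real.log 2 ^ 2 / 4 / t))⁻¹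
        ≤ ((Real.log 2 ^ 2 / 4 / t) ^ (N + 1) / (N + 1).factorial)⁻¹ := inv_anti₀ hpos h1
      _ = (N + 1).factorial * t ^ (N + 1) / (Real.log 2 ^ 2 / 4) ^ (N + 1) := by
        rw [div_pow]
        field_simp
  -- `t^{N+1}/√t = tᴺ √t ≤ tᴺ ≤ t^{N/2}` on `(0, 1]`
  have hs1 : √t ≤ 1 := by
    rw [show (1 : ℝ) = √1 from Real.sqrt_one.symm]
    exact Real.sqrt_le_sqrt ht1
  have hNN : t ^ (N + 1) / √t ≤ t ^ ((N : ℝ) / 2) := by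
    rw [pow_succ, mul_div_assoc, Real.div_sqrt]
    calc t ^ N * √t ≤ t ^ N * 1 := mul_le_mul_of_nonneg_left hs1 (pow_nonneg ht.le N)
      _ = t ^ (N : ℝ) := by rw [mul_one, Real.rpow_natCast]
      _ ≤ t ^ ((N : ℝ) / 2) :=
        Real.rpow_le_rpow_of_exponent_ge ht ht1 (by have := (N.cast_nonneg : (0 : ℝ) ≤ N); linarith)
  calc |heatPrimeSum t|
      ≤ 4 * (π ^ 2 / 6 - 1) * (Real.exp (-Real.log 2 ^ 2 / (4 * t)) / (√π * √t)) := hψ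
    _ ≤ 4 * (π ^ 2 / 6 - 1) *
        (((N + 1).factorial * t ^ (N + 1) / (Real.log 2 ^ 2 / 4) ^ (N + 1)) / (√π * √t)) :=
        mul_le_mul_of_nonneg_left (div_le_div_of_nonneg_right hexp (by positivity)) hc
    _ = 4 * (π ^ 2 / 6 - 1) / √π * ((N + 1).factorial / (Real.log 2 ^ 2 / 4) ^ (N + 1)) *
        (t ^ (N + 1) / √t) := by
        field_simp
    _ ≤ 4 * (π ^ 2 / 6 - 1) / √π * ((N + 1).factorial / (Real.log 2 ^ 2 / 4) ^ (N + 1)) *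
        t ^ ((N : ℝ) / 2) := mul_le_mul_of_nonneg_left hNN (by positivity)

/-! ## Step 4: Theorem 1.1 -/

/-- **Connes 2024, Theorem 1.1 = Connes 2026 Letter, Theorem 7.3 — PROVED** (discharge of the named fact
`Connes2024_heat_thm_1_1`, conditional on RH exactly as printed): under RH the heat trace
`Tr(e^{−tD²}) = Σ_ρ m(ρ)e^{−t(Im ρ)²}` converges for every `t > 0` and, for every `N`,
`Tr(e^{−tD²}) − (log(1/t)/(4√π√t) − (log 4π + γ/2)/(2√π√t) + 2e^{t/4} + Σ_{n<N} a_n t^{n/2}) = O(t^{N/2})` as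
`t → 0⁺`.  Proof = §§2–4 as printed: the explicit formula for `F_t` (part A), `−W_ℝ(F_t)` = divergent terms
`− ∫ 2F_t(e^y)r(y)dy` (Step 1 + part C), Lemma 3.2 with remainder (Step 2 + Lemma 3.1 = part B), `ψ(t) = O(t^{N/2})`
(Step 3). [cite: Connes2024HeatExpansion, Thm 1.1 (arXiv p0002:L8–L14), proof §§2–4; Connes2026Letter, Thm 7.3 (arXiv p0026:L10–L16)] -/
theorem Connes2024_heat_thm_1_1_holds : Connes2024_heat_thm_1_1 := by
  intro hRH
  refine ⟨fun t ht => summable_zetaHeatTerm hRH ht, fun N => ?_⟩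
  obtain ⟨C, hC⟩ := abs_heatKernel_sub_sum_le_of_pos N
  obtain ⟨K, hK⟩ := abs_heatPrimeSum_le_rpow N
  have hl : (0 : ℝ) < Real.log 6 / 8 := by
    have := Real.log_pos (by norm_num : (1 : ℝ) < 6); positivity
  refine IsBigO.of_bound (K + C * (2 ^ N * Real.Gamma (((N : ℝ) + 1) / 2) / √π)) ?_
  filter_upwards [Ioc_mem_nhdsGT hl] with t ht
  obtain ⟨ht0, ht1⟩ := ht
  have hpos : 0 < t ^ ((N : ℝ) / 2) := Real.rpow_pos_of_pos ht0 _
  have e : zetaHeatTrace t - (heatMainTerm t + ∑ n ∈ range N, heatCoeff n * t ^ ((n : ℝ) / 2)) =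
      -(heatPrimeSum t + ∫ y in Ioi (0 : ℝ), Real.exp (-y ^ 2 / (4 * t)) / (√π * √t) *
        (Real.exp (y / 2) / (Real.exp y - Real.exp (-y)) - 1 / (2 * y) -
          ∑ n ∈ range N, heatCoeffB n * y ^ n)) := by
    rw [← sub_sub, zetaHeatTrace_sub_heatMainTerm hRH ht0 ht1, integral_twoHeat_mul_r_eq ht0 N]
    ring
  rw [Real.norm_eq_abs, Real.norm_eq_abs, abs_of_pos hpos, e, abs_neg]
  have h1 := hK t ht0 ht1
  have h2 := abs_integral_twoHeat_mul_rem_le ht0 N hC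
  calc |heatPrimeSum t + ∫ y in Ioi (0 : ℝ), Real.exp (-y ^ 2 / (4 * t)) / (√π * √t) *
          (Real.exp (y / 2) / (Real.exp y - Real.exp (-y)) - 1 / (2 * y) -
            ∑ n ∈ range N, heatCoeffB n * y ^ n)|
      ≤ |heatPrimeSum t| + |∫ y in Ioi (0 : ℝ), Real.exp (-y ^ 2 / (4 * t)) / (√π * √t) *
          (Real.exp (y / 2) / (Real.exp y - Real.exp (-y)) - 1 / (2 * y) -
            ∑ n ∈ range N, heatCoeffB n * y ^ n)| := abs_add_le _ _
    _ ≤ K * t ^ ((N : ℝ) / 2) + C * (2 ^ N * t ^ ((N : ℝ) / 2) * Real.Gamma (((N : ℝ) + 1) / 2) / √π) :=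
        add_le_add h1 h2
    _ = (K + C * (2 ^ N * Real.Gamma (((N : ℝ) + 1) / 2) / √π)) * t ^ ((N : ℝ) / 2) := by ring

end Literature.NumberTheory.LFunctions

end
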